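import Literature.MathematicalPhysics.QuantumLattice.HubbardFermiRadiusBandSmooth
import Literature.MathematicalPhysics.QuantumLattice.KohnLuttingerLindhardMeasurable
import Mathlib.Analysis.SpecialFunctions.PolarCoord
import Mathlib.Analysis.Calculus.Deriv.MeanValue
import HarnessLib

/-!
# The shell-volume estimate for the square-lattice band: `|BZ ∩ {|ε - μ| < t}| ≤ C t`

Topic `Literature/MathematicalPhysics/QuantumLattice`; continues `HubbardFermiRadiusBandSmooth`
(the polar Fermi radius `u_ν(θ) = bandFermiRadius ν θ` of `ε(k) = -2(cos k₁ + cos k₂)` over the whole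
band `-4 < ν < 0`, jointly smooth, with level derivative `∂_ν u = 1/∂_tF(θ, u) > 0`).

For levels `μ` in a compact sub-band `[μ₁, μ₂] ⊂ (-4, 0)` the energy shell
`BZ ∩ {p | |ε(p) - μ| < t}` has Lebesgue measure `≤ C_sh · t`, uniformly in `μ` (the density of
states is bounded away from the band edge `-4` and the Van Hove level `0`):

* `exists_pos_le_rayDispersionDt` — on `[a,b] × [-π,π]` (`-4 < a ≤ b < 0`) the radial derivative
  `∂_tF(θ, u_ν(θ))` is bounded below by a positive constant (compactness);
* `bandFermiRadius_sub_le` — **`u_{ν₂}(θ) - u_{ν₁}(θ) ≤ L (ν₂ - ν₁)`** for `a ≤ ν₁ ≤ ν₂ ≤ b`,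
  `|θ| ≤ π` (mean value theorem);
* `exists_shellVolume_le` — **(SV) `vol(BZ ∩ {|ε - μ| < t}) ≤ C_sh t`** for all `t > 0` and
  `μ ∈ [μ₁, μ₂]`: in polar coordinates (`lintegral_comp_polarCoord_symm`) the shell at a small
  width `t < t₀` lies in `{u_{μ-t}(θ) < r < u_{μ+t}(θ)}`, of area `≤ ∫ 7 (u_{μ+t} - u_{μ-t}) dθ ≤ 32πL t`;
  for `t ≥ t₀` the bound `vol(BZ) ≤ (vol BZ / t₀) t` is trivial.

Everything is proved; no definitions. [folklore]
-/

noncomputable section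

open Real Set Filter MeasureTheory MeasureTheory.Measure
open scoped Topology ENNReal

namespace Literature.MathematicalPhysics.QuantumLattice

/-! ### Lipschitz dependence of the band Fermi radius on the level -/

/-- On a compact level range `[a, b] ⊂ (-4, 0)` and `θ ∈ [-π, π]`, the radial derivative of the level
function at the Fermi radius, `∂_tF(θ, u_ν(θ))`, is bounded below by a positive constant. [folklore] -/
theorem exists_pos_le_rayDispersionDt {a b : ℝ} (ha : -4 < a) (hb : b < 0) :
    ∃ m : ℝ, 0 < m ∧ ∀ ν ∈ Icc a b, ∀ θ ∈ Icc (-π) π, m ≤ rayDispersionDt θ (bandFermiRadius ν θ) := by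
  rcases lt_or_ge b a with hba | hab
  · exact ⟨1, one_pos, fun ν hν => absurd (hν.1.trans hν.2) (not_le.2 hba)⟩
  set K : Set (ℝ × ℝ) := Icc a b ×ˢ Icc (-π) π with hK
  have hKc : IsCompact K := isCompact_Icc.prod isCompact_Icc
  have hKne : K.Nonempty := ⟨(a, 0), ⟨left_mem_Icc.2 hab, by constructor <;> linarith [Real.pi_pos]⟩⟩
  have hsub : K ⊆ Ioo (-4 : ℝ) 0 ×ˢ univ := prod_mono (fun ν hν => ⟨ha.trans_le hν.1, hν.2.trans_lt hb⟩)
    (subset_univ _)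
  have hgc : ContinuousOn (fun p : ℝ × ℝ => rayDispersionDt p.2 (bandFermiRadius p.1 p.2)) K := by
    have hpair : ContinuousOn (fun p : ℝ × ℝ => ((p.2, bandFermiRadius p.1 p.2) : ℝ × ℝ))
        (Ioo (-4 : ℝ) 0 ×ˢ univ) := continuous_snd.continuousOn.prodMk continuousOn_bandFermiRadius
    have h₀ := continuous_rayDispersionDt.comp_continuousOn hpair
    have h : ContinuousOn (fun p : ℝ × ℝ => rayDispersionDt p.2 (bandFermiRadius p.1 p.2))
        (Ioo (-4 : ℝ) 0 ×ˢ univ) := h₀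
    exact h.mono hsub
  obtain ⟨p₀, hp₀, hmin⟩ := hKc.exists_isMinOn hKne hgc
  refine ⟨rayDispersionDt p₀.2 (bandFermiRadius p₀.1 p₀.2), ?_, fun ν hν θ hθ => ?_⟩
  · have hp₀' := hsub hp₀
    exact rayDispersionDt_bandFermiRadius_pos hp₀'.1.1 hp₀'.1.2 p₀.2
  · have h := hmin (show (ν, θ) ∈ K from ⟨hν, hθ⟩)
    exact h

/-- **The band Fermi radius is Lipschitz in the level, uniformly in the angle**: for
`-4 < a ≤ ν₁ ≤ ν₂ ≤ b < 0` and `|θ| ≤ π`, `u_{ν₂}(θ) - u_{ν₁}(θ) ≤ L (ν₂ - ν₁)` with `L = L(a, b)`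
(mean value theorem with `∂_ν u = 1/∂_tF ≤ 1/m`). [folklore] -/
theorem exists_bandFermiRadius_sub_le {a b : ℝ} (ha : -4 < a) (hb : b < 0) :
    ∃ L : ℝ, 0 ≤ L ∧ ∀ θ ∈ Icc (-π) π, ∀ ν₁ ∈ Icc a b, ∀ ν₂ ∈ Icc a b, ν₁ ≤ ν₂ →
      bandFermiRadius ν₂ θ - bandFermiRadius ν₁ θ ≤ L * (ν₂ - ν₁) := by
  obtain ⟨m, hm0, hm⟩ := exists_pos_le_rayDispersionDt ha hb
  refine ⟨1 / m, by positivity, fun θ hθ ν₁ hν₁ ν₂ hν₂ h12 => ?_⟩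
  have hband : ∀ ν ∈ Icc a b, -4 < ν ∧ ν < 0 := fun ν hν => ⟨ha.trans_le hν.1, hν.2.trans_lt hb⟩
  have hderiv : ∀ ν ∈ Icc a b, HasDerivAt (fun ν' : ℝ => bandFermiRadius ν' θ)
      (1 / rayDispersionDt θ (bandFermiRadius ν θ)) ν := fun ν hν =>
    hasDerivAt_bandFermiRadius_level (hband ν hν).1 (hband ν hν).2 θ
  have hcont : ContinuousOn (fun ν' : ℝ => bandFermiRadius ν' θ) (Icc a b) := fun ν hν =>
    (hderiv ν hν).continuousAt.continuousWithinAt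
  have hdiff : DifferentiableOn ℝ (fun ν' : ℝ => bandFermiRadius ν' θ) (interior (Icc a b)) := by
    rw [interior_Icc]
    exact fun ν hν => (hderiv ν (Ioo_subset_Icc_self hν)).differentiableAt.differentiableWithinAt
  have hle : ∀ ν ∈ interior (Icc a b), deriv (fun ν' : ℝ => bandFermiRadius ν' θ) ν ≤ 1 / m := by
    rw [interior_Icc]
    intro ν hν
    rw [(hderiv ν (Ioo_subset_Icc_self hν)).deriv]
    have hpos := hm0
    exact one_div_le_one_div_of_le hm0 (hm ν (Ioo_subset_Icc_self hν) θ hθ)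
  exact (convex_Icc a b).image_sub_le_mul_sub_of_deriv_le hcont hdiff hle ν₁ hν₁ ν₂ hν₂ h12

/-! ### The energy shell in polar coordinates -/

/-- For a point `(r cos θ, r sin θ)` of the square `|x|, |y| ≤ π` with `r > 0`:
`r · ‖dir θ‖ ≤ π` (sup norm) and `r ≤ 8`. [folklore] -/
theorem polar_mem_square_bounds {r θ : ℝ} (hr : 0 < r) (h1 : |r * Real.cos θ| ≤ π) (h2 : |r * Real.sin θ| ≤ π) :
    r * ‖dir θ‖ ≤ π ∧ r ≤ 8 := by
  rw [abs_mul, abs_of_pos hr] at h1 h2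
  refine ⟨?_, ?_⟩
  · rw [norm_dir]
    rcases le_total |Real.cos θ| |Real.sin θ| with h | h
    · rw [max_eq_right h]; exact h2
    · rw [max_eq_left h]; exact h1
  · have hc1 := Real.abs_cos_le_one θ
    have hs1 := Real.abs_sin_le_one θ
    have hcs : 1 ≤ |Real.cos θ| + |Real.sin θ| := by
      have h := Real.cos_sq_add_sin_sq θ
      rw [← sq_abs (Real.cos θ), ← sq_abs (Real.sin θ)] at h
      nlinarith [abs_nonneg (Real.cos θ), abs_nonneg (Real.sin θ)]
    have hπ := Real.pi_le_four
    nlinarith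

/-- **The energy shell in polar coordinates.** For band levels `ν₁ ≤ ν₂` in `(-4, 0)`, a point
`(r cos θ, r sin θ)` (`r > 0`) of the square `[-π, π)²` with `ν₁ < ε < ν₂` has
`u_{ν₁}(θ) < r < u_{ν₂}(θ)` (radial strict monotonicity of `ε` inside the square). [folklore] -/
theorem bandFermiRadius_lt_of_polar_mem {ν₁ ν₂ : ℝ} (h₁ : -4 < ν₁) (h₁' : ν₁ < 0) (h₂ : -4 < ν₂) (h₂' : ν₂ < 0)
    {r θ : ℝ} (hr : 0 < r) (hx : |r * Real.cos θ| ≤ π) (hy : |r * Real.sin θ| ≤ π)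
    (hlo : ν₁ < rayDispersion (θ, r)) (hhi : rayDispersion (θ, r) < ν₂) :
    bandFermiRadius ν₁ θ < r ∧ r < bandFermiRadius ν₂ θ := by
  have hn := norm_dir_pos θ
  have hrm : r ∈ Icc 0 (π / ‖dir θ‖) :=
    ⟨hr.le, by rw [le_div_iff₀ hn]; exact (polar_mem_square_bounds hr hx hy).1⟩
  have hmono := strictMonoOn_rayDispersion_band θ
  have hm1 : bandFermiRadius ν₁ θ ∈ Icc 0 (π / ‖dir θ‖) := (isBandFermiRadius_bandFermiRadius h₁ h₁' θ).mem_Icc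
  have hm2 : bandFermiRadius ν₂ θ ∈ Icc 0 (π / ‖dir θ‖) := (isBandFermiRadius_bandFermiRadius h₂ h₂' θ).mem_Icc
  constructor
  · rw [← hmono.lt_iff_lt hm1 hrm]
    show rayDispersion (θ, bandFermiRadius ν₁ θ) < rayDispersion (θ, r)
    rw [rayDispersion_bandFermiRadius h₁ h₁']
    exact hlo
  · rw [← hmono.lt_iff_lt hrm hm2]
    show rayDispersion (θ, r) < rayDispersion (θ, bandFermiRadius ν₂ θ)
    rw [rayDispersion_bandFermiRadius h₂ h₂']
    exact hhi

/-! ### (SV) the shell-volume estimate -/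

/-- The energy shell written in the coordinates `(k₀, k₁) ∈ ℝ × ℝ`. [folklore] -/
theorem shell_eq_preimage (μ t : ℝ) :
    brillouinZone ∩ {p : Momentum | |squareDispersion 1 0 p - μ| < t} =
      (fun k : Momentum => ((k 0, k 1) : ℝ × ℝ)) ⁻¹'
        {x : ℝ × ℝ | (x.1 ∈ Ico (-π) π ∧ x.2 ∈ Ico (-π) π) ∧ |-2 * (Real.cos x.1 + Real.cos x.2) - μ| < t} := by
  ext k
  simp only [brillouinZone, mem_inter_iff, mem_setOf_eq, mem_preimage, Fin.forall_fin_two, squareDispersion]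
  constructor
  · rintro ⟨⟨h0, h1⟩, h⟩
    exact ⟨⟨h0, h1⟩, by convert h using 3; ring⟩
  · rintro ⟨⟨h0, h1⟩, h⟩
    exact ⟨⟨h0, h1⟩, by convert h using 3; ring⟩

/-- The planar shell is measurable. [folklore] -/
theorem measurableSet_planarShell (μ t : ℝ) :
    MeasurableSet {x : ℝ × ℝ | (x.1 ∈ Ico (-π) π ∧ x.2 ∈ Ico (-π) π) ∧
      |-2 * (Real.cos x.1 + Real.cos x.2) - μ| < t} := by
  have h1 : MeasurableSet {x : ℝ × ℝ | x.1 ∈ Ico (-π) π ∧ x.2 ∈ Ico (-π) π} := by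
    have : {x : ℝ × ℝ | x.1 ∈ Ico (-π) π ∧ x.2 ∈ Ico (-π) π} = Ico (-π) π ×ˢ Ico (-π) π := by
      ext x; simp [mem_prod]
    rw [this]
    exact measurableSet_Ico.prod measurableSet_Ico
  have hc : Continuous fun x : ℝ × ℝ => |-2 * (Real.cos x.1 + Real.cos x.2) - μ| := by fun_prop
  exact h1.inter (measurableSet_lt hc.measurable measurable_const)

/-- **(SV) The shell-volume estimate**: for a compact sub-band `[μ₁, μ₂] ⊂ (-4, 0)` there is
`C_sh ≥ 0` with `vol(BZ ∩ {|ε - μ| < t}) ≤ C_sh · t` for all `μ ∈ [μ₁, μ₂]` and all `t > 0`.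
[folklore] -/
theorem exists_shellVolume_le {μ₁ μ₂ : ℝ} (hμ₁ : -4 < μ₁) (hμ₂ : μ₂ < 0) :
    ∃ Csh : ℝ, 0 ≤ Csh ∧ ∀ μ ∈ Icc μ₁ μ₂, ∀ t : ℝ, 0 < t →
      volume (brillouinZone ∩ {p : Momentum | |squareDispersion 1 0 p - μ| < t}) ≤ ENNReal.ofReal (Csh * t) := by
  rcases lt_or_ge μ₂ μ₁ with h21 | h12
  · exact ⟨0, le_rfl, fun μ hμ => absurd (hμ.1.trans hμ.2) (not_le.2 h21)⟩
  -- widened band `[a, b]` and the width threshold `t₀`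
  set t₀ : ℝ := min (μ₁ + 4) (-μ₂) / 2 with ht₀
  have ht₀pos : 0 < t₀ := by
    rw [ht₀]; exact half_pos (lt_min (by linarith) (by linarith))
  have ht₀1 : t₀ ≤ (μ₁ + 4) / 2 := by
    rw [ht₀]; exact div_le_div_of_nonneg_right (min_le_left _ _) two_pos.le
  have ht₀2 : t₀ ≤ -μ₂ / 2 := by
    rw [ht₀]; exact div_le_div_of_nonneg_right (min_le_right _ _) two_pos.le
  set a : ℝ := μ₁ - t₀ with ha
  set b : ℝ := μ₂ + t₀ with hb
  have ha4 : -4 < a := by rw [ha]; linarith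
  have hb0 : b < 0 := by rw [hb]; linarith
  obtain ⟨L, hL0, hL⟩ := exists_bandFermiRadius_sub_le ha4 hb0
  set V : ℝ := (volume brillouinZone).toReal with hV
  have hV0 : 0 ≤ V := ENNReal.toReal_nonneg
  refine ⟨max (32 * π * L) (V / t₀), le_max_of_le_left (by positivity), fun μ hμ t ht => ?_⟩
  rcases le_or_gt t₀ t with hlarge | hsmall
  · -- large widths: the whole zone
    calc volume (brillouinZone ∩ {p : Momentum | |squareDispersion 1 0 p - μ| < t})
        ≤ volume brillouinZone := measure_mono inter_subset_left
      _ = ENNReal.ofReal V := by rw [hV, ENNReal.ofReal_toReal volume_brillouinZone_lt_top.ne]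
      _ ≤ ENNReal.ofReal (max (32 * π * L) (V / t₀) * t) := by
          refine ENNReal.ofReal_le_ofReal ?_
          calc V = V / t₀ * t₀ := by field_simp
            _ ≤ V / t₀ * t := by gcongr
            _ ≤ max (32 * π * L) (V / t₀) * t := by gcongr; exact le_max_right _ _
  -- small widths: polar coordinates
  have hμt1 : μ - t ∈ Icc a b := ⟨by rw [ha]; linarith [hμ.1], by rw [hb]; linarith [hμ.2]⟩
  have hμt2 : μ + t ∈ Icc a b := ⟨by rw [ha]; linarith [hμ.1], by rw [hb]; linarith [hμ.2]⟩
  have hband : ∀ ν ∈ Icc a b, -4 < ν ∧ ν < 0 := fun ν hν => ⟨ha4.trans_le hν.1, hν.2.trans_lt hb0⟩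
  set E' : Set (ℝ × ℝ) := {x : ℝ × ℝ | (x.1 ∈ Ico (-π) π ∧ x.2 ∈ Ico (-π) π) ∧
    |-2 * (Real.cos x.1 + Real.cos x.2) - μ| < t} with hE'
  have hE'm : MeasurableSet E' := measurableSet_planarShell μ t
  -- transfer to the plane
  have hvolE : volume (brillouinZone ∩ {p : Momentum | |squareDispersion 1 0 p - μ| < t}) = volume E' := by
    rw [shell_eq_preimage, measurePreserving_momentum_prod.measure_preimage hE'm.nullMeasurableSet]
  rw [hvolE]
  -- the radial window
  set R₁ : ℝ → ℝ := fun θ => bandFermiRadius (μ - t) θ with hR₁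
  set R₂ : ℝ → ℝ := fun θ => bandFermiRadius (μ + t) θ with hR₂
  have hR₁c : Continuous R₁ := continuous_bandFermiRadius (hband _ hμt1).1 (hband _ hμt1).2
  have hR₂c : Continuous R₂ := continuous_bandFermiRadius (hband _ hμt2).1 (hband _ hμt2).2
  set g : ℝ × ℝ → ℝ≥0∞ := fun q => ENNReal.ofReal 8 *
    {q : ℝ × ℝ | R₁ q.2 < q.1 ∧ q.1 < R₂ q.2}.indicator (fun _ => (1 : ℝ≥0∞)) q with hg
  have hWm : MeasurableSet {q : ℝ × ℝ | R₁ q.2 < q.1 ∧ q.1 < R₂ q.2} :=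
    (measurableSet_lt (hR₁c.measurable.comp measurable_snd) measurable_fst).inter
      (measurableSet_lt measurable_fst (hR₂c.measurable.comp measurable_snd))
  have hgm : Measurable g := (measurable_const.indicator hWm).const_mul _
  -- polar coordinates and the pointwise bound on the target
  have hpolar : volume E' = ∫⁻ q in polarCoord.target, ENNReal.ofReal q.1 • E'.indicator (1 : ℝ × ℝ → ℝ≥0∞) (polarCoord.symm q) := by
    rw [lintegral_comp_polarCoord_symm (E'.indicator 1), lintegral_indicator_one hE'm]
  have hpt : ∀ q ∈ polarCoord.target,
      ENNReal.ofReal q.1 • E'.indicator (1 : ℝ × ℝ → ℝ≥0∞) (polarCoord.symm q) ≤ g q := by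
    rintro ⟨r, θ⟩ hq
    simp only [polarCoord_target, mem_prod, mem_Ioi, mem_Ioo] at hq
    by_cases hmem : polarCoord.symm (r, θ) ∈ E'
    · rw [indicator_of_mem hmem, Pi.one_apply, smul_eq_mul, mul_one]
      simp only [polarCoord_symm_apply] at hmem
      obtain ⟨⟨hx, hy⟩, hε⟩ := hmem
      have hx' : |r * Real.cos θ| ≤ π := abs_le.2 ⟨hx.1, hx.2.le⟩
      have hy' : |r * Real.sin θ| ≤ π := abs_le.2 ⟨hy.1, hy.2.le⟩
      have hray : rayDispersion (θ, r) = -2 * (Real.cos (r * Real.cos θ) + Real.cos (r * Real.sin θ)) :=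
        rayDispersion_eq (θ, r)
      rw [← hray] at hε
      have hwin := bandFermiRadius_lt_of_polar_mem (hband _ hμt1).1 (hband _ hμt1).2 (hband _ hμt2).1
        (hband _ hμt2).2 hq.1 hx' hy' (by linarith [(abs_lt.1 hε).1]) (by linarith [(abs_lt.1 hε).2])
      have hr8 : r ≤ 8 := (polar_mem_square_bounds hq.1 hx' hy').2
      rw [hg]
      simp only
      rw [indicator_of_mem (show ((r, θ) : ℝ × ℝ) ∈ {q : ℝ × ℝ | R₁ q.2 < q.1 ∧ q.1 < R₂ q.2} from hwin), mul_one]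
      exact ENNReal.ofReal_le_ofReal hr8
    · rw [indicator_of_notMem hmem, smul_zero]
      exact bot_le
  -- integrate the bound
  have hI : ∫⁻ q in polarCoord.target, g q ≤ ENNReal.ofReal (32 * π * L * t) := by
    rw [polarCoord_target, show (volume : Measure (ℝ × ℝ)) = (volume : Measure ℝ).prod volume from rfl,
      ← Measure.prod_restrict, lintegral_prod_symm _ hgm.aemeasurable]
    -- inner integral in `r`
    have hinner : ∀ θ ∈ Ioo (-π) π, ∫⁻ r in Ioi (0 : ℝ), g (r, θ) ≤ ENNReal.ofReal (8 * (L * (2 * t))) := by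
      intro θ hθ
      have hθ' : θ ∈ Icc (-π) π := Ioo_subset_Icc_self hθ
      have hdiff : R₂ θ - R₁ θ ≤ L * (2 * t) := by
        have h := hL θ hθ' (μ - t) hμt1 (μ + t) hμt2 (by linarith)
        rw [show μ + t - (μ - t) = 2 * t by ring] at h
        exact h
      have hgr : ∀ r, g (r, θ) = ENNReal.ofReal 8 * (Ioo (R₁ θ) (R₂ θ)).indicator 1 r := fun r => by
        simp only [hg, indicator, mem_setOf_eq, mem_Ioo, Pi.one_apply]
      calc ∫⁻ r in Ioi (0 : ℝ), g (r, θ)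
          ≤ ∫⁻ r, g (r, θ) := lintegral_mono' Measure.restrict_le_self le_rfl
        _ = ENNReal.ofReal 8 * volume (Ioo (R₁ θ) (R₂ θ)) := by
            simp_rw [hgr]
            rw [lintegral_const_mul' _ _ ENNReal.ofReal_ne_top, lintegral_indicator_one measurableSet_Ioo]
        _ = ENNReal.ofReal 8 * ENNReal.ofReal (R₂ θ - R₁ θ) := by rw [Real.volume_Ioo]
        _ ≤ ENNReal.ofReal 8 * ENNReal.ofReal (L * (2 * t)) := by gcongr
        _ = ENNReal.ofReal (8 * (L * (2 * t))) := (ENNReal.ofReal_mul (by norm_num)).symm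
    calc ∫⁻ θ in Ioo (-π) π, ∫⁻ r in Ioi (0 : ℝ), g (r, θ)
        ≤ ∫⁻ θ in Ioo (-π) π, ENNReal.ofReal (8 * (L * (2 * t))) :=
          setLIntegral_mono measurable_const hinner
      _ = ENNReal.ofReal (8 * (L * (2 * t))) * volume (Ioo (-π) π) := by
          rw [setLIntegral_const]
      _ = ENNReal.ofReal (32 * π * L * t) := by
          rw [Real.volume_Ioo, ← ENNReal.ofReal_mul (by positivity)]
          congr 1
          have : π - -π = 2 * π := by ring
          rw [this]; ring_nf
  calc volume E' = ∫⁻ q in polarCoord.target, ENNReal.ofReal q.1 • E'.indicator (1 : ℝ × ℝ → ℝ≥0∞) (polarCoord.symm q) := hpolar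
    _ ≤ ∫⁻ q in polarCoord.target, g q := setLIntegral_mono hgm hpt
    _ ≤ ENNReal.ofReal (32 * π * L * t) := hI
    _ ≤ ENNReal.ofReal (max (32 * π * L) (V / t₀) * t) := by
        refine ENNReal.ofReal_le_ofReal ?_
        gcongr
        exact le_max_left _ _

end Literature.MathematicalPhysics.QuantumLattice

end
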